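import Summits.SmoothPoincare4.SmoothPoincare4.Theses.CylinderEntropy
import Literature.Geometry.Riemannian.SphericalCylinderEntropy
import Literature.Geometry.Riemannian.ColdingMinicozziEntropyValuesProofs
import HarnessLib

/-!
# `funnels-not-walls` — NEGATIVE-SIDE hand-over (crux-plan verdict: NO SKELETON)

Crux `CylinderEntropy.ThinCrossSectionExists` (= E, stmt-SmoothPoincare4-7633), idea card
`Cruxes/ThinCrossSectionExists/Ideas/funnels-not-walls.md`, triage r1-1/2/3 pass ×3 with the common
sharpening "the deliverable is the vertical-transport (wall) lemma as a NEGATIVE lemma for the disprover;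
drop E ⇔ E_pleat".  This file is NOT a Line skeleton (no theorem here concludes E, by design: every
checkable statement of the idea is a LOWER bound on `λ_cyl`, i.e. an exclusion, and E is an upper-bound
existence statement).  It types — and where cheap, proves — the lever, for the standing disprover
(`Disproof.lean` §3 / `Theorems/ThinCrossSectionExists/Negative/`) and for round-2 ideators:

* §1 `Wall S a b` (the vertical wall `S × [a,b]` over a subset `S` of the slice `S⁴ × {0}`), `plant r`
  (a Euclidean `Y ⊂ ℝ⁴` planted in the slice at scale `r`), `cylEntropy_mono`.
* §2 PROVED: **walls are paid in area** in the `μH[4]`-form the triage asked for —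
  `wall_ratio_le_cylEntropy : (μH⁴ S⁴)⁻¹ · μH⁴(Wall S a b) ≤ λ_cyl(A)` whenever `Wall S a b ⊆ A`
  (monotonicity + the tree's `measure_ratio_le_cylEntropy`; compactness of `S` gives measurability).
* §3 TYPED as named `Prop`s (hypotheses, never axioms): `HausdorffWallProduct` (Federer 2.10.45-type
  product bound, ∃ universal constant), `WallEntropyTransfer` (sub-unit-scale kernel factorisation:
  a wall of height `≥ L·r` over `Y` planted at scale `r ≤ r₀` costs `≥ (1-ε)·λ_{ℝ⁴}(Y)`),
  `BernsteinWang2022_lowEntropy_sphere_three` (arXiv:2003.13858 Thm 1.1, n = 3, diffeomorphism form: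
  `λ(Y³) ≤ λ(S²×ℝ) ⇒ Y ≅ S³`; not in the tree).
* §4 PROVED from §3 as hypotheses: `level_le_cylEntropy_of_tall_wall` — a set `A ⊆ N` containing a
  tall thin wall over a compact connected `Y³ ⊂ B̄(0,1) ⊂ ℝ⁴` that is NOT diffeomorphic to `S³` has
  `λ_cyl(A) ≥ 4/e`; hence (`not_thin_of_tall_wall`) no thin cross-section contains such a wall.

Normalisations: `cylEntropy` is ratio-normalised (`μH[4](A)/μH[4](S⁴)`), `gaussianEntropy 3` uses the
normalised `μHE[3]`; the transfer is stated for images of smooth embeddings only (rectifiable), where no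
`2^d/ω_d` constant can leak (triage r1-1 (i), r1-3 block D).
-/

noncomputable section

open MeasureTheory Set
open scoped Manifold ContDiff ENNReal Topology BigOperators ContinuousMap

namespace Summit.SmoothPoincare4.SmoothPoincare4.Cruxes.ThinCrossSectionExists.FunnelsNotWalls

open Literature.Geometry.Riemannian
open Literature.Geometry.Riemannian.SphericalCylinderEntropy (cylKernel cylDensity cylEntropy
  measure_ratio_le_cylEntropy hausdorffMeasure_sphere_four_pos hausdorffMeasure_sphere_four_lt_top)
open Summit.SmoothPoincare4.SmoothPoincare4.Theses.CylinderEntropy (ThinCrossSectionExists)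

set_option linter.dupNamespace false

local notation "E4" => EuclideanSpace ℝ (Fin 4)
local notation "E5" => EuclideanSpace ℝ (Fin 5)
local notation "E6" => EuclideanSpace ℝ (Fin 6)

/-! ## §1 Objects -/

/-- `z ∈ N = S⁴ × ℝ ⊂ ℝ⁶`, literally as in the route items. -/
def InN (z : E6) : Prop := ∑ i : Fin 5, z (Fin.castSucc i) ^ 2 = 1

/-- The slice `S⁴ × {0}`. -/
def slice₀ : Set E6 := {z | InN z ∧ z 5 = 0}

/-- The unit vertical vector `e₅`. -/
def e₅ : E6 := EuclideanSpace.single (5 : Fin 6) (1 : ℝ)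

@[simp] lemma e₅_apply_five : e₅ 5 = 1 := by simp [e₅]

@[simp] lemma e₅_apply_castSucc (i : Fin 5) : e₅ (Fin.castSucc i) = 0 := by
  have : (Fin.castSucc i : Fin 6) ≠ 5 := by
    intro h
    have := congrArg Fin.val h
    simp at this
    omega
  simp [e₅, this]

/-- The vertical WALL `S × [a, b]` over a subset `S` of the slice: `{z + t e₅ | z ∈ S, t ∈ [a,b]}`. -/
def Wall (S : Set E6) (a b : ℝ) : Set E6 :=
  {w | ∃ z ∈ S, ∃ t ∈ Set.Icc a b, w = z + t • e₅}

/-- The wall as a continuous image of `S × [a,b]`. -/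
lemma wall_eq_image (S : Set E6) (a b : ℝ) :
    Wall S a b = (fun q : E6 × ℝ => q.1 + q.2 • e₅) '' (S ×ˢ Set.Icc a b) := by
  ext w
  simp only [Wall, Set.mem_setOf_eq, Set.mem_image, Set.mem_prod, Prod.exists]
  constructor
  · rintro ⟨z, hz, t, ht, rfl⟩
    exact ⟨z, t, ⟨hz, ht⟩, rfl⟩
  · rintro ⟨z, t, ⟨hz, ht⟩, rfl⟩
    exact ⟨z, hz, t, ht, rfl⟩

lemma isCompact_wall {S : Set E6} (hS : IsCompact S) (a b : ℝ) : IsCompact (Wall S a b) := by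
  rw [wall_eq_image]
  exact (hS.prod isCompact_Icc).image (by fun_prop)

lemma measurableSet_wall {S : Set E6} (hS : IsCompact S) (a b : ℝ) : MeasurableSet (Wall S a b) :=
  (isCompact_wall hS a b).isClosed.measurableSet

/-- Points of a wall over the slice lie in `N` … -/
lemma inN_of_mem_wall {S : Set E6} (hS : S ⊆ slice₀) {a b : ℝ} {w : E6} (hw : w ∈ Wall S a b) :
    InN w := by
  obtain ⟨z, hz, t, -, rfl⟩ := hw
  have hzN := (hS hz).1
  unfold InN at hzN ⊢
  simpa [PiLp.add_apply, PiLp.smul_apply] using hzN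

/-- … at height `t ∈ [a, b]`. -/
lemma apply_five_of_mem_wall {S : Set E6} (hS : S ⊆ slice₀) {a b : ℝ} {w : E6}
    (hw : w ∈ Wall S a b) : w 5 ∈ Set.Icc a b := by
  obtain ⟨z, hz, t, ht, rfl⟩ := hw
  have hz5 := (hS hz).2
  simpa [PiLp.add_apply, PiLp.smul_apply, hz5] using ht

lemma abs_apply_five_le_of_mem_wall {S : Set E6} (hS : S ⊆ slice₀) {a b : ℝ} {w : E6}
    (hw : w ∈ Wall S a b) : |w 5| ≤ max |a| |b| := by
  obtain ⟨ha, hb⟩ := apply_five_of_mem_wall hS hw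
  rcases le_or_gt 0 (w 5) with h | h
  · rw [abs_of_nonneg h]
    exact le_trans (hb.trans (le_abs_self b)) (le_max_right _ _)
  · rw [abs_of_neg h]
    have : -(w 5) ≤ |a| := by
      have := neg_le_abs a
      linarith
    exact this.trans (le_max_left _ _)

/-- `λ_cyl` is monotone in the set (the functional is a sup of restricted lower integrals). -/
theorem cylEntropy_mono {A B : Set E6} (h : A ⊆ B) : cylEntropy A ≤ cylEntropy B := by
  unfold cylEntropy cylDensity
  refine iSup_mono fun p => iSup_mono fun _ => iSup_mono fun τ => iSup_mono fun _ => ?_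
  exact mul_le_mul_right (lintegral_mono_set h) _

/-- PLANTING a Euclidean set in the slice at scale `r`: `y ↦ (r y, √(1 - r²‖y‖²), 0)` (the graph
chart of the upper hemisphere of `S⁴ × {0}` about the pole `(0,0,0,0,1,0)`, precomposed with the
dilation by `r`; an `r`-scaled isometry up to `O(r²‖y‖²)` on `‖y‖ ≤ 1`). -/
def plant (r : ℝ) (y : E4) : E6 :=
  WithLp.toLp 2 fun i : Fin 6 =>
    if h : (i : ℕ) < 4 then r * y ⟨i, h⟩
    else if (i : ℕ) = 4 then Real.sqrt (1 - r ^ 2 * ‖y‖ ^ 2) else 0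

/-! ## §2 Walls are paid in area (PROVED) -/

/-- **Walls are paid in area** (`μH[4]`-form): the typed cylinder entropy of a wall over a compact
subset of the slice is at least its `μH⁴`-measure over `μH⁴(S⁴)` — the `τ → ∞` end of the sup
(tree `measure_ratio_le_cylEntropy`). -/
theorem wall_ratio_le_cylEntropy_self {S : Set E6} (hS : S ⊆ slice₀) (hSc : IsCompact S) (a b : ℝ) :
    (μH[4] (Metric.sphere (0 : E5) 1))⁻¹ * μH[4] (Wall S a b) ≤ cylEntropy (Wall S a b) :=
  measure_ratio_le_cylEntropy (measurableSet_wall hSc a b) (fun _ hw => inN_of_mem_wall hS hw)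
    (B := max |a| |b|) (fun _ hw => abs_apply_five_le_of_mem_wall hS hw)

/-- **Walls are paid in area, inside any set**: if `A ⊇ Wall S a b` then
`(μH⁴ S⁴)⁻¹ · μH⁴(Wall S a b) ≤ λ_cyl(A)`.  With the product bound of §3 this is the card's
`wall_cost` `(b-a)·μH³(S)/|S⁴| ≲ λ_cyl(A)`; with `measure_lt_of_cylEntropy_lt` (Disproof §2) a thin
cross-section has total wall measure `< (4/e)·μH⁴(S⁴)`. -/
theorem wall_ratio_le_cylEntropy {A S : Set E6} (hS : S ⊆ slice₀) (hSc : IsCompact S) {a b : ℝ}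
    (hW : Wall S a b ⊆ A) :
    (μH[4] (Metric.sphere (0 : E5) 1))⁻¹ * μH[4] (Wall S a b) ≤ cylEntropy A :=
  (wall_ratio_le_cylEntropy_self hS hSc a b).trans (cylEntropy_mono hW)

/-- Corollary: a set of typed entropy `< c` contains no wall of measure `≥ c · μH⁴(S⁴)`. -/
theorem measure_wall_lt_of_cylEntropy_lt {A S : Set E6} (hS : S ⊆ slice₀) (hSc : IsCompact S)
    {a b : ℝ} (hW : Wall S a b ⊆ A) {c : ℝ≥0∞} (hlt : cylEntropy A < c) :
    μH[4] (Wall S a b) < c * μH[4] (Metric.sphere (0 : E5) 1) := by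
  have h2 : (μH[4] (Metric.sphere (0 : E5) 1))⁻¹ * μH[4] (Wall S a b) < c :=
    lt_of_le_of_lt (wall_ratio_le_cylEntropy hS hSc hW) hlt
  have hpos := hausdorffMeasure_sphere_four_pos
  have htop := hausdorffMeasure_sphere_four_lt_top
  calc μH[4] (Wall S a b)
      = μH[4] (Metric.sphere (0 : E5) 1) * ((μH[4] (Metric.sphere (0 : E5) 1))⁻¹ * μH[4] (Wall S a b)) := by
        rw [← mul_assoc, ENNReal.mul_inv_cancel hpos.ne' htop.ne, one_mul]
    _ = (μH[4] (Metric.sphere (0 : E5) 1))⁻¹ * μH[4] (Wall S a b) * μH[4] (Metric.sphere (0 : E5) 1) :=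
        mul_comm _ _
    _ < c * μH[4] (Metric.sphere (0 : E5) 1) := ENNReal.mul_lt_mul_left hpos.ne' htop.ne h2

/-! ## §3 The three inputs of the lever, typed as named `Prop`s (hypotheses; none is in the tree) -/

/-- **Product lower bound for walls** (Federer 1969, 2.10.45-type; not in Mathlib): there is a
universal constant `c > 0` with `c · (b - a) · μH³(S) ≤ μH⁴(S × [a,b])` for every compact subset `S`
of the slice (for Mathlib's un-normalised `μH`; on 3-rectifiable `S` the sharp constant is a ratio of
the `2^d/ω_d` normalisations, triage r1-1 (i)). [cite: Federer1969, 2.10.45] -/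
def HausdorffWallProduct : Prop :=
  ∃ c : ℝ≥0∞, 0 < c ∧ ∀ (S : Set E6), S ⊆ slice₀ → IsCompact S → ∀ a b : ℝ, a ≤ b →
    c * ENNReal.ofReal (b - a) * μH[3] S ≤ μH[4] (Wall S a b)

/-- **Wall-entropy transfer at sub-unit scales** (the card's "kernel factorises, the height Gaussian
saturates"): for every `ε > 0` there are `L > 0` and `r₀ ∈ (0,1)` such that for every compact
`3`-manifold `Y` smoothly embedded in the closed unit ball of `ℝ⁴`, every scale `0 < r ≤ r₀` and
every height interval with `b - a ≥ L r`, the typed cylinder entropy of the wall over the planted copy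
`plant r (Y)` is at least `(1 - ε) · λ_{ℝ⁴}(Y)` (Colding–Minicozzi entropy, `gaussianEntropy 3`).
Mechanism: centres of near-optimal Euclidean windows for `Y ⊂ B̄(0,1)` lie in `B̄(0,2)` with scales
`≤ 3/2`, so the transplanted windows have scale `≤ 3r²/2 ≪ 1`, where
`vol(S⁴)·H_{S⁴}(x,p';τ)·e^{-(s-s_p)²/4τ} = (4πτ)^{-2}·√(4πτ)·e^{-d²/4τ}(1 + O(τ + d²))` and the vertical
Gaussian of a wall of height `≥ L r` integrates to `≥ (1-ε/2)√(4πτ)`; `plant r` is an `r`-scaled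
isometry up to `O(r²)`.  Unpublished lemma (folklore-grade heat-kernel asymptotics). [folklore] -/
def WallEntropyTransfer : Prop :=
  ∀ ε : ℝ, 0 < ε → ∃ L : ℝ, 0 < L ∧ ∃ r₀ : ℝ, 0 < r₀ ∧ r₀ < 1 ∧
    ∀ (Y : Type) [TopologicalSpace Y] [T2Space Y] [SecondCountableTopology Y] [CompactSpace Y]
      [ChartedSpace (EuclideanSpace ℝ (Fin 3)) Y] [IsManifold (𝓡 3) ∞ Y] (j : Y → E4),
      Manifold.IsSmoothEmbedding (𝓡 3) (𝓡 4) ∞ j → Set.range j ⊆ Metric.closedBall (0 : E4) 1 →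
      ∀ r : ℝ, 0 < r → r ≤ r₀ → ∀ a b : ℝ, L * r ≤ b - a →
        ENNReal.ofReal (1 - ε) * gaussianEntropy 3 (Set.range j) ≤
          cylEntropy (Wall (plant r '' Set.range j) a b)

/-- **Bernstein–Wang, low-entropy closed hypersurfaces of `ℝ⁴` are spheres** — arXiv:2003.13858 =
Duke Math. J. 171 (2022), Thm 1.1 (p. 3, L17–18, read by triage r1-1/2/3): "a closed connected
hypersurface `Σ ⊂ ℝ⁴` with `λ[Σ] ≤ λ[S² × ℝ]` is smoothly isotopic to the round `S³`".  Rendered in the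
tree's language, DIFFEOMORPHISM form only (isotopy dropped; threshold `λ(shrinkingCylinder 3 2) =
λ(S²(2) × ℝ) = 4/e` by `Stone1994_cylinderEntropy_holds`).  NOT in the tree (grounder note on 7632):
to be vendored as a named fact if the disprover adopts §4. [cite: arXiv:2003.13858, Thm 1.1] -/
def BernsteinWang2022_lowEntropy_sphere_three : Prop :=
  ∀ (Y : Type) [TopologicalSpace Y] [T2Space Y] [SecondCountableTopology Y] [CompactSpace Y]
    [ConnectedSpace Y] [ChartedSpace (EuclideanSpace ℝ (Fin 3)) Y] [IsManifold (𝓡 3) ∞ Y]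
    (j : Y → E4), Manifold.IsSmoothEmbedding (𝓡 3) (𝓡 4) ∞ j →
    gaussianEntropy 3 (Set.range j) ≤ gaussianEntropy 3 (shrinkingCylinder 3 2) →
      Nonempty (Y ≃ₘ⟮𝓡 3, 𝓡 3⟯ (Metric.sphere (0 : E4) 1))

/-! ## §4 The exclusion lemma of the line (PROVED from §3 as hypotheses) -/

/-- The bubble-sheet level `4/e`, as typed in the crux. -/
def level : ℝ≥0∞ := ENNReal.ofReal (4 / Real.exp 1)

lemma gaussianEntropy_shrinkingCylinder_three_two :
    gaussianEntropy 3 (shrinkingCylinder 3 2) = level := by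
  rw [level, ← sphereEntropy_two]
  exact Stone1994_cylinderEntropy_holds 3 2 (by norm_num) (by norm_num)

/-- BW contrapositive: a compact connected embedded `Y³ ⊂ ℝ⁴` not diffeomorphic to `S³` has
`λ_{ℝ⁴}(Y) > 4/e` (strict). -/
lemma level_lt_gaussianEntropy_of_not_sphere (hBW : BernsteinWang2022_lowEntropy_sphere_three)
    (Y : Type) [TopologicalSpace Y] [T2Space Y] [SecondCountableTopology Y] [CompactSpace Y]
    [ConnectedSpace Y] [ChartedSpace (EuclideanSpace ℝ (Fin 3)) Y] [IsManifold (𝓡 3) ∞ Y]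
    (j : Y → E4) (hj : Manifold.IsSmoothEmbedding (𝓡 3) (𝓡 4) ∞ j)
    (hY : IsEmpty (Y ≃ₘ⟮𝓡 3, 𝓡 3⟯ (Metric.sphere (0 : E4) 1))) :
    level < gaussianEntropy 3 (Set.range j) := by
  by_contra h
  rw [not_lt, ← gaussianEntropy_shrinkingCylinder_three_two] at h
  obtain ⟨φ⟩ := hBW Y j hj h
  exact hY.false φ

/-- Elementary: if `level < l` in `ℝ≥0∞` then some `ε ∈ (0,1)` has `level ≤ ofReal (1 - ε) * l`. -/
lemma exists_eps_of_level_lt {l : ℝ≥0∞} (h : level < l) :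
    ∃ ε : ℝ, 0 < ε ∧ ε < 1 ∧ level ≤ ENNReal.ofReal (1 - ε) * l := by
  rcases eq_or_ne l ⊤ with rfl | hl
  · refine ⟨1 / 2, by norm_num, by norm_num, ?_⟩
    rw [ENNReal.mul_top (by norm_num)]
    exact le_top
  · have hl0 : l ≠ 0 := by
      rintro rfl
      simp at h
    have hlpos : 0 < l.toReal := ENNReal.toReal_pos hl0 hl
    have hlt : 4 / Real.exp 1 < l.toReal := by
      have := (ENNReal.ofReal_lt_iff_lt_toReal (by positivity) hl).1 h
      exact this
    have h4pos : 0 < 4 / Real.exp 1 := by positivity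
    refine ⟨1 - (4 / Real.exp 1) / l.toReal, ?_, ?_, ?_⟩
    · have : (4 / Real.exp 1) / l.toReal < 1 := (div_lt_one hlpos).2 hlt
      linarith
    · have : 0 < (4 / Real.exp 1) / l.toReal := div_pos h4pos hlpos
      linarith
    · have hsimp : 1 - (1 - (4 / Real.exp 1) / l.toReal) = (4 / Real.exp 1) / l.toReal := by ring
      rw [hsimp, level, ← ENNReal.ofReal_toReal hl, ← ENNReal.ofReal_mul (by positivity),
        ENNReal.ofReal_toReal hl]
      refine ENNReal.ofReal_le_ofReal (le_of_eq ?_)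
      field_simp

/-- **No tall thin walls over non-round `Y`.**  Given the transfer and Bernstein–Wang: for every
compact connected `Y³` smoothly embedded in `B̄(0,1) ⊂ ℝ⁴` and NOT diffeomorphic to `S³` there are
`L > 0`, `r₀ > 0` such that every `A ⊆ ℝ⁶` containing the wall of height `≥ L r` over the copy of
`Y` planted in the slice at any scale `0 < r ≤ r₀` has typed cylinder entropy `≥ 4/e`. -/
theorem level_le_cylEntropy_of_tall_wall (hT : WallEntropyTransfer)
    (hBW : BernsteinWang2022_lowEntropy_sphere_three)
    (Y : Type) [TopologicalSpace Y] [T2Space Y] [SecondCountableTopology Y] [CompactSpace Y]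
    [ConnectedSpace Y] [ChartedSpace (EuclideanSpace ℝ (Fin 3)) Y] [IsManifold (𝓡 3) ∞ Y]
    (j : Y → E4) (hj : Manifold.IsSmoothEmbedding (𝓡 3) (𝓡 4) ∞ j)
    (hball : Set.range j ⊆ Metric.closedBall (0 : E4) 1)
    (hY : IsEmpty (Y ≃ₘ⟮𝓡 3, 𝓡 3⟯ (Metric.sphere (0 : E4) 1))) :
    ∃ L : ℝ, 0 < L ∧ ∃ r₀ : ℝ, 0 < r₀ ∧ ∀ r : ℝ, 0 < r → r ≤ r₀ → ∀ a b : ℝ, L * r ≤ b - a →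
      ∀ A : Set E6, Wall (plant r '' Set.range j) a b ⊆ A → level ≤ cylEntropy A := by
  obtain ⟨ε, hε, -, hεl⟩ := exists_eps_of_level_lt (level_lt_gaussianEntropy_of_not_sphere hBW Y j hj hY)
  obtain ⟨L, hL, r₀, hr₀, -, H⟩ := hT ε hε
  refine ⟨L, hL, r₀, hr₀, fun r hr hrr a b hab A hA => ?_⟩
  calc level ≤ ENNReal.ofReal (1 - ε) * gaussianEntropy 3 (Set.range j) := hεl
    _ ≤ cylEntropy (Wall (plant r '' Set.range j) a b) := H Y j hj hball r hr hrr a b hab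
    _ ≤ cylEntropy A := cylEntropy_mono hA

/-- The same, read as an EXCLUSION for the crux: no `A` with `λ_cyl(A) < 4/e` — in particular no
thin cross-section `range ι` — contains a tall thin wall over a non-round `Y`
(`ThinCrossSection_false_with_tall_wall_over_Y`, the family of statements the card offers the
standing disprover; kills the Schoenflies-cap-with-collar pictures `V×{0} ∪ ∂V×[0,H] ∪ cap` at small or
tall collars). -/
theorem not_thin_of_tall_wall (hT : WallEntropyTransfer)
    (hBW : BernsteinWang2022_lowEntropy_sphere_three)
    (Y : Type) [TopologicalSpace Y] [T2Space Y] [SecondCountableTopology Y] [CompactSpace Y]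
    [ConnectedSpace Y] [ChartedSpace (EuclideanSpace ℝ (Fin 3)) Y] [IsManifold (𝓡 3) ∞ Y]
    (j : Y → E4) (hj : Manifold.IsSmoothEmbedding (𝓡 3) (𝓡 4) ∞ j)
    (hball : Set.range j ⊆ Metric.closedBall (0 : E4) 1)
    (hY : IsEmpty (Y ≃ₘ⟮𝓡 3, 𝓡 3⟯ (Metric.sphere (0 : E4) 1))) :
    ∃ L : ℝ, 0 < L ∧ ∃ r₀ : ℝ, 0 < r₀ ∧ ∀ r : ℝ, 0 < r → r ≤ r₀ → ∀ a b : ℝ, L * r ≤ b - a →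
      ∀ A : Set E6, Wall (plant r '' Set.range j) a b ⊆ A → ¬ cylEntropy A < level := by
  obtain ⟨L, hL, r₀, hr₀, H⟩ := level_le_cylEntropy_of_tall_wall hT hBW Y j hj hball hY
  exact ⟨L, hL, r₀, hr₀, fun r hr hrr a b hab A hA hlt => absurd (H r hr hrr a b hab A hA) (not_le.2 hlt)⟩

/-- Sanity link to the crux: `level` is the crux threshold and `cylEntropy` its functional, verbatim
(so `not_thin_of_tall_wall` constrains exactly the witnesses `ι` that E asks for). -/
example : ThinCrossSectionExists ↔
    ∀ (M : Type) [TopologicalSpace M] [T2Space M] [SecondCountableTopology M]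
      [ChartedSpace (EuclideanSpace ℝ (Fin 4)) M] [IsManifold (𝓡 4) ∞ M],
      M ≃ₕ Metric.sphere (0 : E5) 1 → ∃ ι : M → E6, Manifold.IsSmoothEmbedding (𝓡 4) (𝓡 6) ∞ ι ∧
        (∀ x, InN (ι x)) ∧ (∃ R : ℝ, ∀ a b : E6, InN a → InN b → a 5 ≤ -R → R ≤ b 5 →
          ¬ JoinedIn ({z : E6 | InN z} \ Set.range ι) a b) ∧ cylEntropy (Set.range ι) < level :=
  Iff.rfl

end Summit.SmoothPoincare4.SmoothPoincare4.Cruxes.ThinCrossSectionExists.FunnelsNotWalls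

end
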